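import Literature.MathematicalPhysics.QuantumFieldTheory.Balaban1983to89.B9SectBL2DictionaryY
import Literature.MathematicalPhysics.QuantumFieldTheory.Balaban1983to89.B9Eq38CrossLettersL2
import Literature.MathematicalPhysics.QuantumFieldTheory.Balaban1983to89.B9SectBGpTransferConvY

/-!
# `Balaban1983to89.B9SectBL2TransferInY` — THE INPUT HALF OF THE `L²` TRANSFER AT THE RECORD: NODE 00's six (3.46) members at a base `U` READ as
# block-`ℓ²` majorants of print's six words (letters at `U`), and from them the AUGMENTED (3.46) members 0, 1, 2, 4 of `KSC₃` at `base U` (all sign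
# combinations, by the cross conversions); the same-side second-difference members 3, 5 LOCATED (plaquette of the base)

T. Bałaban, *Propagators for lattice gauge theories in a background field*, Commun. Math. Phys. **99** (1985) 389–434
[`Balaban1985BackgroundPropagators`, "B9"]; [4] = T. Bałaban, *Propagators and renormalization transformations for lattice gauge
theories. II*, Commun. Math. Phys. **96** (1984) 223–250 [`Balaban1984PropagatorsII`].

statement-level skeleton of published theorems with citation tags; proofs where landed; nothing here is a claim about the
Yang–Mills mass gap

THE PRINTED LOCI.  Theorem 3.1 (3.46) p. 398 (the six `L²` quantities `‖hG′λ‖, ‖h∇_UG′λ‖, ‖hG′∇*_Uλ‖, ‖h∇_U∇_UG′λ‖, ‖h∇_UG′∇*_Uλ‖, ‖hG′∇*_U∇*_Uλ‖`);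
p. 398, first remark («we may always replace ∇_U by ∇*_U, and vice versa, in arbitrary place and combination»); p. 403 l.1–9; [4] Prop. 2.6 (2.140)
p. 247, (2.51) p. 232, Lemma 2.1 p. 234.

WHY THIS FILE (pub-ymgap N06 row 13, seat dag-n06-c gen 9).  The hypothesis `hin` of `B9SectBStepFamilyTransfer.sectBStepPrinted_of_family` for the readings
`KSC₃` (the `L²` twin of gen 7's `B9SectBGpTransferInY` for `KSC`): at a regular base `U`, the record's (3.46) block (print's six orientation patterns)
must give the AUGMENTED block of `KSC₃` (every orientation pattern).  §1 READS the record's block as block-`ℓ²` majorants of the six conj-`b` words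
(`B9SectBL2DictionaryY.hasL2Majorant_conj_of_indBound`; entry 0 is gen 8's `B9SectBL2ReadingsY.hasL2Majorant_conj_of_l2Block`); §2 produces EVERY
orientation pattern of the words with at most one difference on each side by `B9Eq38CrossLettersL2.hasL2Majorant_cross_left ∕ _right` ([4] (2.141) with
Lemma 2.1, rate `δ₀ ↦ δ₀/2`), and the two cheap same-side patterns; §3 writes the augmented members 0, 1, 2, 4 of `KSC₃` at `base U`
(`B9SectBL2DictionaryY.l2AugS_le_of_hasL2Majorant_wordL`).
* §1 ★ `hasL2Majorant_recordWords_of_l2Block` — the five reads r1 … r5 (entries `∇_μG`, `G∇*_μ`, `∇_μG∇*_ν`, `∇_μ∇_νG`, `G∇*_μ∇*_ν`) at any configuration.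
* §2 ★ `hasL2Majorant_firstOrder_all_of_l2Block` (all `∇♯_kG`, `G∇♯_k`), ★ `hasL2Majorant_mixed_all_of_l2Block` (all `∇♯_kG∇♯_l`), `hasL2Majorant_left_inl ∕
  _right_inr_of_l2Block` (the same-side patterns `∇♯_k∇♯_{inl ν}G`, `G∇♯_{inr μ}∇♯_l` that need no plaquette).
* §3 ★★ `l2_KSC₃_base_of_record` — members `0, 1, 2, 4` of `KSC₃` at `base U` from the record's (3.46) block at `U`, (2.61) and the transfers of `ℓ, ℓ²`
  at `(δ₀, 1/12)` given (constant explicit, rate `δ₀/2`).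

HONEST SCOPE ∕ LOCATED.  Members 3 and 5 of `KSC₃` at a base (left resp. right SECOND differences over ALL orientation pairs) are NOT produced: the
patterns `∇♯_{inl μ}∇♯_{inr ν}G`, `∇♯_{inr μ}∇♯_{inr ν}G`, `G∇♯_{inl μ}∇♯_{inl ν}`, `G∇♯_{inl μ}∇♯_{inr ν}` put a transport letter BETWEEN two differences,
whose commutator with `∇_U` is the plaquette of `U` — the located estimate of this member (bus ME 2026-08-28, `B9SectBL2TransferConvY` §3).  Everything
here is finite-dimensional operator algebra over NODE 00's DEFINED readings; the record's (3.46) block is the HYPOTHESIS; per-member `hι` (corner-free).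
COUNT-NEUTRAL; N06 NOT discharged; nothing continuum ∕ OS ∕ mass-gap ∕ Clay.  Cell `pub-ymgap` (HUMAN RULING D-0062), Track A node N06 [B9], row 13, 2026-08-28.

RELATED IN THE TREE, NOT DUPLICATED: `B9SectBGpTransferInY` (gen 7: the (3.42) twin), `Node00.OpsYRead342Cross` (def-Y: sup cross entries),
`B9SectBL2ReadingsY` (entry 0), `B9SectBL2DictionaryY`, `B9Eq38CrossLettersL2`, `B9SectBGpTransferConvY` (`letters337`-style record geometry lemmas).
-/

noncomputable section

namespace Literature.MathematicalPhysics.QuantumFieldTheory.Balaban1983to89.B9SectBL2TransferInY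

open Literature.MathematicalPhysics.QuantumFieldTheory.Balaban1983to89
open Literature.MathematicalPhysics.QuantumFieldTheory.Balaban1983to89.B6KLevelCensusIndexV1 (KIdx kGeo)
open Literature.MathematicalPhysics.QuantumFieldTheory.Balaban1983to89.B6Ineq2142KLevelV1 (β)
open Literature.MathematicalPhysics.QuantumFieldTheory.Balaban1983to89.B6RandomWalk (Triangle254 Ineq261)
open Literature.MathematicalPhysics.QuantumFieldTheory.Balaban1983to89.B6RandomWalkL2 (HasL2Majorant hasL2Majorant_mono)
open Literature.MathematicalPhysics.QuantumFieldTheory.Balaban1983to89.B9Thm34Ext (toB6)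
open Literature.MathematicalPhysics.QuantumFieldTheory.Balaban1983to89.B9Ineq347 (ScaleTransfer)
open Literature.MathematicalPhysics.QuantumFieldTheory.Balaban1983to89.B9FromB6 (L2Block pref6_nonneg)
open Literature.MathematicalPhysics.QuantumFieldTheory.Balaban1983to89.B9Eq352DivFormLetters (conj)
open Literature.MathematicalPhysics.QuantumFieldTheory.Balaban1983to89.B9Eq352GradLetters (diffLetter)
open Literature.MathematicalPhysics.QuantumFieldTheory.Balaban1983to89.B9SectBCodedCarrier (CCfg)
open Literature.MathematicalPhysics.QuantumFieldTheory.Balaban1983to89.B9Eq360DeltaPrimeAY (AfldY)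
open Literature.MathematicalPhysics.QuantumFieldTheory.Balaban1983to89.B9PinMembersKLevelV1 (MemberY geo9Y bg9Y)
open Literature.MathematicalPhysics.QuantumFieldTheory.Balaban1983to89.B9SectBGpLettersY (GVal blkC stencilF_blkC stencilB_blkC norm_le_one_and_inv_of_mem)
open Literature.MathematicalPhysics.QuantumFieldTheory.Balaban1983to89.B9SectBGpFrameCodedY (codingYx)
open Literature.MathematicalPhysics.QuantumFieldTheory.Balaban1983to89.B9SectBGpReadingsY (suppIn_inl_of_blkC etaS_eq_eta len_label dist_label off_of_suppIn_inl)
open Literature.MathematicalPhysics.QuantumFieldTheory.Balaban1983to89.B9SectBL2ReadingsY (indY indY_nonneg_le_one supF_indY_le_one cutIn_indY)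
open Literature.MathematicalPhysics.QuantumFieldTheory.Balaban1983to89.B9SectBL2DictionaryY (wordSL wordL e6 dirS l2AugS KSC₃ KSC₃_l2 hasL2Majorant_conj_of_indBound
  l2OfY_wordL l2OfY_le_of_pointwise l2AugS_le_of_hasL2Majorant_wordL abs_le_cutSup_inl cut_off_of_cutIn_inl l2OfY_liftY_le_of_hasL2Majorant_conj)
open Literature.MathematicalPhysics.QuantumFieldTheory.Balaban1983to89.B9Eq38CrossLettersL2 (hasL2Majorant_cross_left hasL2Majorant_cross_right)
open Literature.MathematicalPhysics.QuantumFieldTheory.Balaban1983to89.B9Ineq363L2 (hasL2Majorant_rate_mono)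
open Literature.MathematicalPhysics.QuantumFieldTheory.Balaban1983to89.B9GeoLemma21KLevelV1 (geo9Y_dist_triangle geo9Y_len_pos geo9K_eta_pos)
open Literature.MathematicalPhysics.QuantumFieldTheory.Balaban1983to89.B9RWSums347DefiniteFacesWindow (geo9Y_dist_nonneg)
open Literature.MathematicalPhysics.QuantumFieldTheory.Balaban1983to89.B9Thm314WholeExpansionReads (le_iSup_ball)
open Literature.MathematicalPhysics.QuantumFieldTheory.Balaban1983to89.Node00 (SiteY BlkY IBondY CfgY BallY SiteOpY SiteParY UboxY shiftY cdS cdsS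
  liftY l2OfY etaS kernelFamilyS GpY)

variable {𝔸 : Type} [NormedRing 𝔸] [NormedAlgebra ℂ 𝔸] [CompleteSpace 𝔸] [FiniteDimensional ℝ 𝔸]
variable {d ℓ : ℕ} {hd : 1 ≤ d + 1} {hL : Odd (ℓ + 1) ∧ 1 < ℓ + 1} {b₀ b₁ : ℝ} {Mstar : ℕ}

/-! ## §1 ★ Reading the record's (3.46) block as block-`ℓ²` majorants of print's six words -/

section Read

variable (x : MemberY d ℓ hd hL b₀ b₁ Mstar) (ιB : BlkY x.toKIdx → IBondY x.toKIdx) {ι : Type} [Fintype ι] (b : Module.Basis ι ℝ 𝔸)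
  [Fintype (geo9Y x).Site] [DecidableEq (geo9Y x).Site]

omit [Fintype (geo9Y x).Site] [DecidableEq (geo9Y x).Site] in
/-- a word reading on a product-form input is bounded over the unit ball (any cut-off). [cite: Balaban1985BackgroundPropagators, (3.46) p.398, bookkeeping] -/
theorem exists_ball_bound_word (O : SiteOpY 𝔸 x.toKIdx) (V : CfgY 𝔸 x.toKIdx) (f h : SiteY x.toKIdx → ℝ) (n : Fin 6) (k l : Fin (d + 1) ⊕ Fin (d + 1)) :
    ∃ C : ℝ, ∀ E : BallY 𝔸, l2OfY h (wordSL x.toKIdx O V V n k l (liftY f (E : 𝔸))) ≤ C := by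
  obtain ⟨C₀, -, hC₀⟩ := B9SectBGpReadingsY.exists_ball_bound x ((wordSL x.toKIdx O V V n k l).restrictScalars ℝ) f
  exact ⟨Real.sqrt (∑ z, (h z * C₀) ^ 2), fun E => l2OfY_le_of_pointwise h fun z => hC₀ E z⟩

/-- ★ **THE RECORD's (3.46) BLOCK READ AS BLOCK-`ℓ²` MAJORANTS OF PRINT's WORDS** (orientations as printed: `∇_U` forward on the left, `∇*_U` backward on
the right): at a member with a section `ιB` of `β`, for NODE 00's reading `kernelFamilyS … cfg O par` at `c` (`V = cfg c`), `L2Block … B₀ δ c` (`B₀ ≧ 0`)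
gives, with `c_L = √|ι|·M₂·Σ_j‖b_j‖` and `K_n(a,a′) = c_L·B₀·pref6_n(ℓ(a))·e^{−δd(a,a′)}`: `∇♯_{inl μ}·G ≺₂ K_1`, `G·∇♯_{inr μ} ≺₂ K_2`,
`∇♯_{inl μ}∇♯_{inl ν}·G ≺₂ K_3`, `∇♯_{inl μ}·G·∇♯_{inr ν} ≺₂ K_4`, `G·∇♯_{inr μ}∇♯_{inr ν} ≺₂ K_5` (indices of the frames' words; `G = η²O(V)`, letters at `V`).
[cite: Balaban1985BackgroundPropagators, Thm 3.1 (3.46) p.398; Balaban1984PropagatorsII, Prop. 2.6 (2.140) p.247, (2.51) p.232] -/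
theorem hasL2Majorant_recordWords_of_l2Block (hι : ∀ s : BlkY x.toKIdx, β x.toKIdx.hN x.toKIdx.D x.toKIdx.hk (ιB s) = s)
    {M₂ : ℝ} (hM₂ : 0 ≤ M₂) (hrepr : ∀ (v : 𝔸) (j : ι), |b.repr v j| ≤ M₂ * ‖v‖) (R : ℝ) (H : Prop)
    {B : B9.Backgrounds} (cfg : B.Cfg → CfgY 𝔸 x.toKIdx) (O : SiteOpY 𝔸 x.toKIdx) (par : SiteParY 𝔸 x.toKIdx) {B₀ δ : ℝ} (hB₀ : 0 ≤ B₀) {c : B.Cfg}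
    (hL2 : L2Block (kernelFamilyS x.toKIdx B cfg O par) B₀ δ c) (μ ν : Fin (d + 1)) :
    let K : Fin 6 → IBondY x.toKIdx → IBondY x.toKIdx → ℝ := fun n a a' =>
      (Real.sqrt (Fintype.card ι) * M₂ * ∑ j, ‖b j‖) * B₀ * B9.pref6 ((geo9Y x).len a) n * Real.exp (-(δ * (geo9Y x).dist a a'))
    HasL2Majorant (g := toB6 (geo9Y x) R H) (fun p : SiteY x.toKIdx × ι => blkC x.toKIdx ιB p.1)
        (conj b (wordL x.toKIdx O (cfg c) (cfg c) (kGeo x.toKIdx).eta 1 (Sum.inl μ) (Sum.inl ν))) (K 1) ∧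
      HasL2Majorant (g := toB6 (geo9Y x) R H) (fun p : SiteY x.toKIdx × ι => blkC x.toKIdx ιB p.1)
        (conj b (wordL x.toKIdx O (cfg c) (cfg c) (kGeo x.toKIdx).eta 2 (Sum.inr μ) (Sum.inl ν))) (K 2) ∧
      HasL2Majorant (g := toB6 (geo9Y x) R H) (fun p : SiteY x.toKIdx × ι => blkC x.toKIdx ιB p.1)
        (conj b (wordL x.toKIdx O (cfg c) (cfg c) (kGeo x.toKIdx).eta 3 (Sum.inl μ) (Sum.inl ν))) (K 3) ∧
      HasL2Majorant (g := toB6 (geo9Y x) R H) (fun p : SiteY x.toKIdx × ι => blkC x.toKIdx ιB p.1)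
        (conj b (wordL x.toKIdx O (cfg c) (cfg c) (kGeo x.toKIdx).eta 4 (Sum.inl μ) (Sum.inr ν))) (K 4) ∧
      HasL2Majorant (g := toB6 (geo9Y x) R H) (fun p : SiteY x.toKIdx × ι => blkC x.toKIdx ιB p.1)
        (conj b (wordL x.toKIdx O (cfg c) (cfg c) (kGeo x.toKIdx).eta 5 (Sum.inr μ) (Sum.inr ν))) (K 5) := by
  intro K
  set V := cfg c with hV
  set η := (kGeo x.toKIdx).eta with hηdef
  have hη0 : 0 < η := geo9K_eta_pos x.toKIdx
  have hK0 : ∀ n a a', 0 ≤ B₀ * B9.pref6 ((geo9Y x).len a) n * Real.exp (-(δ * (geo9Y x).dist a a')) := fun n a a' =>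
    mul_nonneg (mul_nonneg hB₀ (pref6_nonneg (geo9Y_len_pos x a).le n)) (Real.exp_pos _).le
  have hWd := fun k l Λ => B9SectBL2DictionaryY.wordSL_apply x.toKIdx O V V k l Λ
  have hD := fun μ' => B9SectBL2DictionaryY.dirS_inl_inr (𝔸 := 𝔸) x.toKIdx V μ'
  -- generic step: a word `(n, k, l)` whose reading at every `(f, E, y)` is below the record's member `m` integrand has the majorant `K m` (with `e6 n = e6 m`)
  have step : ∀ (n m : Fin 6) (k l : Fin (d + 1) ⊕ Fin (d + 1)), e6 n = ((![2, 1, 1, 0, 0, 0] : Fin 6 → ℕ) m) →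
      (∀ (f : SiteY x.toKIdx → ℝ) (hh : SiteY x.toKIdx → ℝ),
        etaS x.toKIdx ^ ((![2, 1, 1, 0, 0, 0] : Fin 6 → ℕ) m) * (⨆ E : BallY 𝔸, l2OfY hh (wordSL x.toKIdx O V V n k l (liftY f (E : 𝔸))))
          ≤ (kernelFamilyS x.toKIdx B cfg O par).l2 m c (.inl f) (.inl hh)) →
      HasL2Majorant (g := toB6 (geo9Y x) R H) (fun p : SiteY x.toKIdx × ι => blkC x.toKIdx ιB p.1)
        (conj b (wordL x.toKIdx O V V η n k l)) (K m) := by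
    intro n m k l he hdom
    have h := hasL2Majorant_conj_of_indBound x ιB b hM₂ hrepr R H (wordL x.toKIdx O V V η n k l)
      (fun a a' => B₀ * B9.pref6 ((geo9Y x).len a) m * Real.exp (-(δ * (geo9Y x).dist a a'))) (hK0 m) ?_
    · exact hasL2Majorant_mono (g := toB6 (geo9Y x) R H) _ h fun a a' => le_of_eq (by simp only [K]; ring)
    intro f E y y' hE1 hoff
    have hind := indY_nonneg_le_one x ιB y
    rw [l2OfY_wordL x.toKIdx O V V hη0, he, show η = etaS x.toKIdx by rw [hηdef, etaS_eq_eta]]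
    have h1 : l2OfY (indY x ιB y) (wordSL x.toKIdx O V V n k l (liftY f E)) ≤
        ⨆ E' : BallY 𝔸, l2OfY (indY x ιB y) (wordSL x.toKIdx O V V n k l (liftY f (E' : 𝔸))) :=
      le_iSup_ball (A := fun E' : BallY 𝔸 => l2OfY (indY x ιB y) (wordSL x.toKIdx O V V n k l (liftY f (E' : 𝔸))))
        (exists_ball_bound_word x O V f (indY x ιB y) n k l) ⟨E, mem_closedBall_zero_iff.2 hE1⟩
    have hread := hL2 m (.inl f) (.inl (indY x ιB y)) y y' (cutIn_indY x ιB hι y) (suppIn_inl_of_blkC x ιB hι hoff)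
    have hcut : (geo9Y x).cutSup (.inl (indY x ιB y)) ≤ 1 := supF_indY_le_one x ιB y
    have hl2n : 0 ≤ (geo9Y x).l2Norm (.inl f) := B9GeoNormsKLevelV1.geo9K_l2Norm_nonneg x.toKIdx _
    have hηS : 0 ≤ etaS x.toKIdx := by rw [etaS_eq_eta]; exact hη0.le
    calc etaS x.toKIdx ^ ((![2, 1, 1, 0, 0, 0] : Fin 6 → ℕ) m) * l2OfY (indY x ιB y) (wordSL x.toKIdx O V V n k l (liftY f E))
        ≤ etaS x.toKIdx ^ ((![2, 1, 1, 0, 0, 0] : Fin 6 → ℕ) m) * ⨆ E' : BallY 𝔸, l2OfY (indY x ιB y) (wordSL x.toKIdx O V V n k l (liftY f (E' : 𝔸))) :=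
          mul_le_mul_of_nonneg_left h1 (pow_nonneg hηS _)
      _ ≤ (kernelFamilyS x.toKIdx B cfg O par).l2 m c (.inl f) (.inl (indY x ιB y)) := hdom f (indY x ιB y)
      _ ≤ B₀ * B9.pref6 ((geo9Y x).len y) m * (geo9Y x).cutSup (.inl (indY x ιB y)) * Real.exp (-(δ * (geo9Y x).dist y y')) *
            (geo9Y x).l2Norm (.inl f) := hread
      _ ≤ B₀ * B9.pref6 ((geo9Y x).len y) m * 1 * Real.exp (-(δ * (geo9Y x).dist y y')) * (geo9Y x).l2Norm (.inl f) := by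
          have h0 : 0 ≤ B₀ * B9.pref6 ((geo9Y x).len y) m := mul_nonneg hB₀ (pref6_nonneg (geo9Y_len_pos x y).le m)
          gcongr
      _ = B₀ * B9.pref6 ((geo9Y x).len y) m * Real.exp (-(δ * (geo9Y x).dist y y')) * (geo9Y x).l2Norm (.inl f) := by ring
  -- the per-member dominations: the specific word IS one term of the record's sup
  have bddμ : ∀ (A : BallY 𝔸 → Fin (d + 1) → ℝ) (E : BallY 𝔸), BddAbove (Set.range (A E)) := fun A E => (Set.finite_range _).bddAbove
  refine ⟨step 1 1 _ _ rfl fun f hh => ?_, step 2 2 _ _ rfl fun f hh => ?_, step 3 4 _ _ rfl fun f hh => ?_, step 4 3 _ _ rfl fun f hh => ?_,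
    step 5 5 _ _ rfl fun f hh => ?_⟩
  · show etaS x.toKIdx ^ 1 * _ ≤ etaS x.toKIdx ^ 1 * ⨆ E : BallY 𝔸, ⨆ μ' : Fin (d + 1), l2OfY hh (cdS x.toKIdx V μ' (O V (liftY f (E : 𝔸))))
    refine mul_le_mul_of_nonneg_left (ciSup_mono ?_ fun E => ?_) (pow_nonneg (by rw [etaS_eq_eta]; exact hη0.le) _)
    · obtain ⟨C, hC⟩ := B9SectBL2DictionaryY.exists_ball_bound_l2LatSC x O V V f hh 1
      refine ⟨C, ?_⟩; rintro _ ⟨E, rfl⟩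
      refine ciSup_le fun μ' => (le_trans ?_ (hC E))
      have := (hWd (Sum.inl μ') (Sum.inl μ') (liftY f (E : 𝔸))).2.1
      rw [(hD μ' _).1] at this
      rw [← this]
      exact le_ciSup (f := fun q : (Fin (d + 1) ⊕ Fin (d + 1)) × (Fin (d + 1) ⊕ Fin (d + 1)) =>
        l2OfY hh (wordSL x.toKIdx O V V 1 q.1 q.2 (liftY f (E : 𝔸)))) (Set.finite_range _).bddAbove (Sum.inl μ', Sum.inl μ')
    · rw [(hWd _ _ _).2.1, (hD μ _).1]
      exact le_ciSup (f := fun μ' => l2OfY hh (cdS x.toKIdx V μ' (O V (liftY f (E : 𝔸))))) (Set.finite_range _).bddAbove μ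
  · show etaS x.toKIdx ^ 1 * _ ≤ etaS x.toKIdx ^ 1 * ⨆ E : BallY 𝔸, ⨆ μ' : Fin (d + 1), l2OfY hh (O V (cdsS x.toKIdx V μ' (liftY f (E : 𝔸))))
    refine mul_le_mul_of_nonneg_left (ciSup_mono ?_ fun E => ?_) (pow_nonneg (by rw [etaS_eq_eta]; exact hη0.le) _)
    · obtain ⟨C, hC⟩ := B9SectBL2DictionaryY.exists_ball_bound_l2LatSC x O V V f hh 2
      refine ⟨C, ?_⟩; rintro _ ⟨E, rfl⟩
      refine ciSup_le fun μ' => (le_trans ?_ (hC E))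
      have := (hWd (Sum.inr μ') (Sum.inl μ') (liftY f (E : 𝔸))).2.2.1
      rw [(hD μ' _).2] at this
      rw [← this]
      exact le_ciSup (f := fun q : (Fin (d + 1) ⊕ Fin (d + 1)) × (Fin (d + 1) ⊕ Fin (d + 1)) =>
        l2OfY hh (wordSL x.toKIdx O V V 2 q.1 q.2 (liftY f (E : 𝔸)))) (Set.finite_range _).bddAbove (Sum.inr μ', Sum.inl μ')
    · rw [(hWd _ _ _).2.2.1, (hD μ _).2]
      exact le_ciSup (f := fun μ' => l2OfY hh (O V (cdsS x.toKIdx V μ' (liftY f (E : 𝔸))))) (Set.finite_range _).bddAbove μ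
  · show etaS x.toKIdx ^ 0 * _ ≤ etaS x.toKIdx ^ 0 *
      ⨆ E : BallY 𝔸, ⨆ μ' : Fin (d + 1), ⨆ ν' : Fin (d + 1), l2OfY hh (cdS x.toKIdx V μ' (cdS x.toKIdx V ν' (O V (liftY f (E : 𝔸)))))
    refine mul_le_mul_of_nonneg_left (ciSup_mono ?_ fun E => ?_) (pow_nonneg (by rw [etaS_eq_eta]; exact hη0.le) _)
    · obtain ⟨C, hC⟩ := B9SectBL2DictionaryY.exists_ball_bound_l2LatSC x O V V f hh 3
      refine ⟨C, ?_⟩; rintro _ ⟨E, rfl⟩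
      refine ciSup_le fun μ' => ciSup_le fun ν' => (le_trans ?_ (hC E))
      have := (hWd (Sum.inl μ') (Sum.inl ν') (liftY f (E : 𝔸))).2.2.2.1
      rw [(hD ν' _).1, (hD μ' _).1] at this
      rw [← this]
      exact le_ciSup (f := fun q : (Fin (d + 1) ⊕ Fin (d + 1)) × (Fin (d + 1) ⊕ Fin (d + 1)) =>
        l2OfY hh (wordSL x.toKIdx O V V 3 q.1 q.2 (liftY f (E : 𝔸)))) (Set.finite_range _).bddAbove (Sum.inl μ', Sum.inl ν')
    · rw [(hWd _ _ _).2.2.2.1, (hD ν _).1, (hD μ _).1]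
      refine le_ciSup_of_le (f := fun μ' => ⨆ ν' : Fin (d + 1), l2OfY hh (cdS x.toKIdx V μ' (cdS x.toKIdx V ν' (O V (liftY f (E : 𝔸))))))
        (Set.finite_range _).bddAbove μ ?_
      exact le_ciSup (f := fun ν' => l2OfY hh (cdS x.toKIdx V μ (cdS x.toKIdx V ν' (O V (liftY f (E : 𝔸)))))) (Set.finite_range _).bddAbove ν
  · show etaS x.toKIdx ^ 0 * _ ≤ etaS x.toKIdx ^ 0 *
      ⨆ E : BallY 𝔸, ⨆ μ' : Fin (d + 1), ⨆ ν' : Fin (d + 1), l2OfY hh (cdS x.toKIdx V μ' (O V (cdsS x.toKIdx V ν' (liftY f (E : 𝔸)))))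
    refine mul_le_mul_of_nonneg_left (ciSup_mono ?_ fun E => ?_) (pow_nonneg (by rw [etaS_eq_eta]; exact hη0.le) _)
    · obtain ⟨C, hC⟩ := B9SectBL2DictionaryY.exists_ball_bound_l2LatSC x O V V f hh 4
      refine ⟨C, ?_⟩; rintro _ ⟨E, rfl⟩
      refine ciSup_le fun μ' => ciSup_le fun ν' => (le_trans ?_ (hC E))
      have := (hWd (Sum.inl μ') (Sum.inr ν') (liftY f (E : 𝔸))).2.2.2.2.1
      rw [(hD ν' _).2, (hD μ' _).1] at this
      rw [← this]
      exact le_ciSup (f := fun q : (Fin (d + 1) ⊕ Fin (d + 1)) × (Fin (d + 1) ⊕ Fin (d + 1)) =>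
        l2OfY hh (wordSL x.toKIdx O V V 4 q.1 q.2 (liftY f (E : 𝔸)))) (Set.finite_range _).bddAbove (Sum.inl μ', Sum.inr ν')
    · rw [(hWd _ _ _).2.2.2.2.1, (hD ν _).2, (hD μ _).1]
      refine le_ciSup_of_le (f := fun μ' => ⨆ ν' : Fin (d + 1), l2OfY hh (cdS x.toKIdx V μ' (O V (cdsS x.toKIdx V ν' (liftY f (E : 𝔸))))))
        (Set.finite_range _).bddAbove μ ?_
      exact le_ciSup (f := fun ν' => l2OfY hh (cdS x.toKIdx V μ (O V (cdsS x.toKIdx V ν' (liftY f (E : 𝔸)))))) (Set.finite_range _).bddAbove ν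
  · show etaS x.toKIdx ^ 0 * _ ≤ etaS x.toKIdx ^ 0 *
      ⨆ E : BallY 𝔸, ⨆ μ' : Fin (d + 1), ⨆ ν' : Fin (d + 1), l2OfY hh (O V (cdsS x.toKIdx V μ' (cdsS x.toKIdx V ν' (liftY f (E : 𝔸)))))
    refine mul_le_mul_of_nonneg_left (ciSup_mono ?_ fun E => ?_) (pow_nonneg (by rw [etaS_eq_eta]; exact hη0.le) _)
    · obtain ⟨C, hC⟩ := B9SectBL2DictionaryY.exists_ball_bound_l2LatSC x O V V f hh 5
      refine ⟨C, ?_⟩; rintro _ ⟨E, rfl⟩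
      refine ciSup_le fun μ' => ciSup_le fun ν' => (le_trans ?_ (hC E))
      have := (hWd (Sum.inr μ') (Sum.inr ν') (liftY f (E : 𝔸))).2.2.2.2.2
      rw [(hD ν' _).2, (hD μ' _).2] at this
      rw [← this]
      exact le_ciSup (f := fun q : (Fin (d + 1) ⊕ Fin (d + 1)) × (Fin (d + 1) ⊕ Fin (d + 1)) =>
        l2OfY hh (wordSL x.toKIdx O V V 5 q.1 q.2 (liftY f (E : 𝔸)))) (Set.finite_range _).bddAbove (Sum.inr μ', Sum.inr ν')
    · rw [(hWd _ _ _).2.2.2.2.2, (hD ν _).2, (hD μ _).2]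
      refine le_ciSup_of_le (f := fun μ' => ⨆ ν' : Fin (d + 1), l2OfY hh (O V (cdsS x.toKIdx V μ' (cdsS x.toKIdx V ν' (liftY f (E : 𝔸))))))
        (Set.finite_range _).bddAbove μ ?_
      exact le_ciSup (f := fun ν' => l2OfY hh (O V (cdsS x.toKIdx V μ (cdsS x.toKIdx V ν' (liftY f (E : 𝔸)))))) (Set.finite_range _).bddAbove ν

omit [FiniteDimensional ℝ 𝔸] in
/-- ★ **WRITE INTO THE RECORD FROM PRINT's PATTERNS ONLY** (the converse direction, sharper than `B9SectBL2TransferConvY.l2Block_kernelFamilyS_of_hasL2Majorant_wordL`,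
which asks for all `4·6` sign patterns): at a member with a section `ιB` of `β`, block-`ℓ²` majorants `B′·pref6_n(ℓ(a))·e^{−δd}` (`B′ ≧ 0`) of the words of
print's patterns alone — `G`, `∇♯_{inl μ}G`, `G∇♯_{inr μ}`, `∇♯_{inl μ}∇♯_{inl ν}G`, `∇♯_{inl μ}G∇♯_{inr ν}`, `G∇♯_{inr μ}∇♯_{inr ν}` (letters and operator at
`V = cfg c`, `G = η²O(V)`) — give the (3.46) block of NODE 00's reading `kernelFamilyS … cfg O par` at `c` with `(c_L·B′, δ)`, `c_L = √|ι|·M₂·Σ_j‖b_j‖`.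
[cite: Balaban1985BackgroundPropagators, Thm 3.1 (3.46) p.398, Thm 3.4 p.400; Balaban1984PropagatorsII, Prop. 2.6 (2.140) p.247] -/
theorem l2Block_kernelFamilyS_of_printWords (hι : ∀ s : BlkY x.toKIdx, β x.toKIdx.hN x.toKIdx.D x.toKIdx.hk (ιB s) = s)
    {M₂ : ℝ} (hM₂ : 0 ≤ M₂) (hrepr : ∀ (v : 𝔸) (j : ι), |b.repr v j| ≤ M₂ * ‖v‖) (R : ℝ) (H : Prop)
    {B : B9.Backgrounds} (cfg : B.Cfg → CfgY 𝔸 x.toKIdx) (O : SiteOpY 𝔸 x.toKIdx) (par : SiteParY 𝔸 x.toKIdx) {B' δ : ℝ} (hB' : 0 ≤ B') {c : B.Cfg}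
    (hW0 : HasL2Majorant (g := toB6 (geo9Y x) R H) (fun p : SiteY x.toKIdx × ι => blkC x.toKIdx ιB p.1)
      (conj b (wordL x.toKIdx O (cfg c) (cfg c) (kGeo x.toKIdx).eta 0 (Sum.inl ⟨0, hd⟩) (Sum.inl ⟨0, hd⟩)))
      (fun a a' => B' * B9.pref6 ((geo9Y x).len a) 0 * Real.exp (-(δ * (geo9Y x).dist a a'))))
    (hW1 : ∀ μ : Fin (d + 1), HasL2Majorant (g := toB6 (geo9Y x) R H) (fun p : SiteY x.toKIdx × ι => blkC x.toKIdx ιB p.1)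
      (conj b (wordL x.toKIdx O (cfg c) (cfg c) (kGeo x.toKIdx).eta 1 (Sum.inl μ) (Sum.inl ⟨0, hd⟩)))
      (fun a a' => B' * B9.pref6 ((geo9Y x).len a) 1 * Real.exp (-(δ * (geo9Y x).dist a a'))))
    (hW2 : ∀ μ : Fin (d + 1), HasL2Majorant (g := toB6 (geo9Y x) R H) (fun p : SiteY x.toKIdx × ι => blkC x.toKIdx ιB p.1)
      (conj b (wordL x.toKIdx O (cfg c) (cfg c) (kGeo x.toKIdx).eta 2 (Sum.inr μ) (Sum.inl ⟨0, hd⟩)))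
      (fun a a' => B' * B9.pref6 ((geo9Y x).len a) 2 * Real.exp (-(δ * (geo9Y x).dist a a'))))
    (hW3 : ∀ μ ν : Fin (d + 1), HasL2Majorant (g := toB6 (geo9Y x) R H) (fun p : SiteY x.toKIdx × ι => blkC x.toKIdx ιB p.1)
      (conj b (wordL x.toKIdx O (cfg c) (cfg c) (kGeo x.toKIdx).eta 3 (Sum.inl μ) (Sum.inl ν)))
      (fun a a' => B' * B9.pref6 ((geo9Y x).len a) 3 * Real.exp (-(δ * (geo9Y x).dist a a'))))
    (hW4 : ∀ μ ν : Fin (d + 1), HasL2Majorant (g := toB6 (geo9Y x) R H) (fun p : SiteY x.toKIdx × ι => blkC x.toKIdx ιB p.1)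
      (conj b (wordL x.toKIdx O (cfg c) (cfg c) (kGeo x.toKIdx).eta 4 (Sum.inl μ) (Sum.inr ν)))
      (fun a a' => B' * B9.pref6 ((geo9Y x).len a) 4 * Real.exp (-(δ * (geo9Y x).dist a a'))))
    (hW5 : ∀ μ ν : Fin (d + 1), HasL2Majorant (g := toB6 (geo9Y x) R H) (fun p : SiteY x.toKIdx × ι => blkC x.toKIdx ιB p.1)
      (conj b (wordL x.toKIdx O (cfg c) (cfg c) (kGeo x.toKIdx).eta 5 (Sum.inr μ) (Sum.inr ν)))
      (fun a a' => B' * B9.pref6 ((geo9Y x).len a) 5 * Real.exp (-(δ * (geo9Y x).dist a a')))) :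
    L2Block (kernelFamilyS x.toKIdx B cfg O par) ((Real.sqrt (Fintype.card ι) * M₂ * ∑ j, ‖b j‖) * B') δ c := by
  intro n lam h y y' hcut hsupp
  have hη0 : 0 < etaS x.toKIdx := by rw [etaS_eq_eta]; exact geo9K_eta_pos x.toKIdx
  set η := etaS x.toKIdx with hηdef
  set V := cfg c with hV
  set cL : ℝ := Real.sqrt (Fintype.card ι) * M₂ * ∑ j, ‖b j‖ with hcL
  have hcL0 : 0 ≤ cL := by positivity
  have hpref : ∀ m : Fin 6, 0 ≤ B9.pref6 ((geo9Y x).len y) m := pref6_nonneg (geo9Y_len_pos x y).le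
  have hcs : 0 ≤ (geo9Y x).cutSup h := B9GeoNormsKLevelV1.geo9K_cutSup_nonneg x.toKIdx h
  have hl2n : 0 ≤ (geo9Y x).l2Norm lam := B9GeoNormsKLevelV1.geo9K_l2Norm_nonneg x.toKIdx lam
  set ex := Real.exp (-(δ * (geo9Y x).dist y y')) with hex
  have hRHS : 0 ≤ (cL * B') * B9.pref6 ((geo9Y x).len y) n * (geo9Y x).cutSup h * ex * (geo9Y x).l2Norm lam := by
    have := hpref n; positivity
  match lam, h with
  | .inr _, .inl _ => exact hRHS
  | .inr _, .inr _ => exact hRHS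
  | .inl _, .inr _ => exact hRHS
  | .inl f, .inl hh =>
    set ŷ := ιB (β x.toKIdx.hN x.toKIdx.D x.toKIdx.hk y) with hŷ
    set ŷ' := ιB (β x.toKIdx.hN x.toKIdx.D x.toKIdx.hk y') with hŷ'
    have hoff : ∀ w, blkC x.toKIdx ιB w ≠ ŷ' → f w = 0 := off_of_suppIn_inl x ιB hsupp
    have hco : ∀ w, blkC x.toKIdx ιB w ≠ ŷ → hh w = 0 := cut_off_of_cutIn_inl x ιB hcut
    have hhs : ∀ w, |hh w| ≤ (geo9Y x).cutSup (.inl hh) := abs_le_cutSup_inl x hh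
    have hK : ∀ m : Fin 6, B' * B9.pref6 ((geo9Y x).len ŷ) m * Real.exp (-(δ * (geo9Y x).dist ŷ ŷ')) = B' * B9.pref6 ((geo9Y x).len y) m * ex := fun m => by
      rw [hŷ, hŷ', len_label x ιB hι, dist_label x ιB hι]
    -- the bound of one word reading with a majorant of print's pattern
    have hdir : ∀ (m : Fin 6) (k l : Fin (d + 1) ⊕ Fin (d + 1)) (E : BallY 𝔸),
        HasL2Majorant (g := toB6 (geo9Y x) R H) (fun p : SiteY x.toKIdx × ι => blkC x.toKIdx ιB p.1) (conj b (wordL x.toKIdx O V V (kGeo x.toKIdx).eta m k l))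
          (fun a a' => B' * B9.pref6 ((geo9Y x).len a) m * Real.exp (-(δ * (geo9Y x).dist a a'))) →
        η ^ e6 m * l2OfY hh (wordSL x.toKIdx O V V m k l (liftY f (E : 𝔸))) ≤
          (cL * B') * B9.pref6 ((geo9Y x).len y) m * (geo9Y x).cutSup (.inl hh) * ex * (geo9Y x).l2Norm (.inl f) := by
      intro m k l E hWm
      have hE1 : ‖(E : 𝔸)‖ ≤ 1 := mem_closedBall_zero_iff.1 E.2
      have hη0' : 0 < (kGeo x.toKIdx).eta := geo9K_eta_pos x.toKIdx
      rw [hηdef, etaS_eq_eta, ← l2OfY_wordL x.toKIdx O V V hη0']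
      have hw := l2OfY_liftY_le_of_hasL2Majorant_conj x ιB b hM₂ hrepr R H _ _ hWm f (E : 𝔸) hh ŷ ŷ' hE1
        (by rw [hK m]; exact mul_nonneg (mul_nonneg hB' (hpref m)) (Real.exp_pos _).le) hcs hoff hco hhs
      rw [hK m] at hw
      exact hw.trans (le_of_eq (by rw [hcL]; ring))
    have hWd := fun (E : BallY 𝔸) k l => B9SectBL2DictionaryY.wordSL_apply x.toKIdx O V V k l (liftY f (E : 𝔸))
    have hD := fun μ => B9SectBL2DictionaryY.dirS_inl_inr (𝔸 := 𝔸) x.toKIdx V μ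
    -- `η^e · ⨆_E A(E) ≦ M` from `η^e · A(E) ≦ M`
    have key : ∀ (e : ℕ) (A : BallY 𝔸 → ℝ) {M : ℝ}, 0 ≤ M → (∀ E, η ^ e * A E ≤ M) → η ^ e * (⨆ E, A E) ≤ M := by
      intro e A M hM0 hA
      have hsup : (⨆ E, A E) ≤ M / η ^ e := by
        refine Real.iSup_le (fun E => ?_) (div_nonneg hM0 (pow_nonneg hη0.le _))
        rw [le_div_iff₀ (pow_pos hη0 _), mul_comm]
        exact hA E
      calc η ^ e * (⨆ E, A E) ≤ η ^ e * (M / η ^ e) := mul_le_mul_of_nonneg_left hsup (pow_nonneg hη0.le _)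
        _ = M := mul_div_cancel₀ _ (pow_ne_zero _ hη0.ne')
    have key1 : ∀ (e : ℕ) (A : BallY 𝔸 → Fin (d + 1) → ℝ) {M : ℝ}, 0 ≤ M → (∀ E μ, η ^ e * A E μ ≤ M) →
        η ^ e * (⨆ E, ⨆ μ, A E μ) ≤ M := by
      intro e A M hM0 hA
      refine key e _ hM0 fun E => ?_
      have hsup : (⨆ μ, A E μ) ≤ M / η ^ e := by
        refine Real.iSup_le (fun μ => ?_) (div_nonneg hM0 (pow_nonneg hη0.le _))
        rw [le_div_iff₀ (pow_pos hη0 _), mul_comm]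
        exact hA E μ
      calc η ^ e * (⨆ μ, A E μ) ≤ η ^ e * (M / η ^ e) := mul_le_mul_of_nonneg_left hsup (pow_nonneg hη0.le _)
        _ = M := mul_div_cancel₀ _ (pow_ne_zero _ hη0.ne')
    have key2 : ∀ (e : ℕ) (A : BallY 𝔸 → Fin (d + 1) → Fin (d + 1) → ℝ) {M : ℝ}, 0 ≤ M → (∀ E μ ν, η ^ e * A E μ ν ≤ M) →
        η ^ e * (⨆ E, ⨆ μ, ⨆ ν, A E μ ν) ≤ M := by
      intro e A M hM0 hA
      refine key1 e _ hM0 fun E μ => ?_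
      have hsup : (⨆ ν, A E μ ν) ≤ M / η ^ e := by
        refine Real.iSup_le (fun ν => ?_) (div_nonneg hM0 (pow_nonneg hη0.le _))
        rw [le_div_iff₀ (pow_pos hη0 _), mul_comm]
        exact hA E μ ν
      calc η ^ e * (⨆ ν, A E μ ν) ≤ η ^ e * (M / η ^ e) := mul_le_mul_of_nonneg_left hsup (pow_nonneg hη0.le _)
        _ = M := mul_div_cancel₀ _ (pow_ne_zero _ hη0.ne')
    match n with
    | 0 =>
      show η ^ 2 * (⨆ E : BallY 𝔸, l2OfY hh (O V (liftY f (E : 𝔸)))) ≤ _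
      refine key 2 _ hRHS fun E => ?_
      have h := hdir 0 (Sum.inl ⟨0, hd⟩) (Sum.inl ⟨0, hd⟩) E hW0
      rwa [(hWd E _ _).1] at h
    | 1 =>
      show η ^ 1 * (⨆ E : BallY 𝔸, ⨆ μ : Fin (d + 1), l2OfY hh (cdS x.toKIdx V μ (O V (liftY f (E : 𝔸))))) ≤ _
      refine key1 1 _ hRHS fun E μ => ?_
      have h := hdir 1 (Sum.inl μ) (Sum.inl ⟨0, hd⟩) E (hW1 μ)
      rwa [(hWd E _ _).2.1, (hD μ (O V (liftY f (E : 𝔸)))).1] at h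
    | 2 =>
      show η ^ 1 * (⨆ E : BallY 𝔸, ⨆ μ : Fin (d + 1), l2OfY hh (O V (cdsS x.toKIdx V μ (liftY f (E : 𝔸))))) ≤ _
      refine key1 1 _ hRHS fun E μ => ?_
      have h := hdir 2 (Sum.inr μ) (Sum.inl ⟨0, hd⟩) E (hW2 μ)
      rwa [(hWd E _ _).2.2.1, (hD μ (liftY f (E : 𝔸))).2] at h
    | 3 =>
      show η ^ 0 * (⨆ E : BallY 𝔸, ⨆ μ : Fin (d + 1), ⨆ ν : Fin (d + 1), l2OfY hh (cdS x.toKIdx V μ (O V (cdsS x.toKIdx V ν (liftY f (E : 𝔸)))))) ≤ _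
      refine key2 0 _ hRHS fun E μ ν => ?_
      have h := hdir 4 (Sum.inl μ) (Sum.inr ν) E (hW4 μ ν)
      rw [(hWd E _ _).2.2.2.2.1, (hD ν (liftY f (E : 𝔸))).2, (hD μ (O V (cdsS x.toKIdx V ν (liftY f (E : 𝔸))))).1] at h
      exact h.trans (le_of_eq (by simp only [B9.pref6]; rfl))
    | 4 =>
      show η ^ 0 * (⨆ E : BallY 𝔸, ⨆ μ : Fin (d + 1), ⨆ ν : Fin (d + 1), l2OfY hh (cdS x.toKIdx V μ (cdS x.toKIdx V ν (O V (liftY f (E : 𝔸)))))) ≤ _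
      refine key2 0 _ hRHS fun E μ ν => ?_
      have h := hdir 3 (Sum.inl μ) (Sum.inl ν) E (hW3 μ ν)
      rw [(hWd E _ _).2.2.2.1, (hD ν (O V (liftY f (E : 𝔸)))).1, (hD μ (cdS x.toKIdx V ν (O V (liftY f (E : 𝔸))))).1] at h
      exact h.trans (le_of_eq (by simp only [B9.pref6]; rfl))
    | 5 =>
      show η ^ 0 * (⨆ E : BallY 𝔸, ⨆ μ : Fin (d + 1), ⨆ ν : Fin (d + 1), l2OfY hh (O V (cdsS x.toKIdx V μ (cdsS x.toKIdx V ν (liftY f (E : 𝔸)))))) ≤ _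
      refine key2 0 _ hRHS fun E μ ν => ?_
      have h := hdir 5 (Sum.inr μ) (Sum.inr ν) E (hW5 μ ν)
      rwa [(hWd E _ _).2.2.2.2.2, (hD ν (liftY f (E : 𝔸))).2, (hD μ (cdsS x.toKIdx V ν (liftY f (E : 𝔸)))).2] at h

end Read

/-! ## §2 ★ Every orientation pattern with at most one difference on each side, and the cheap same-side patterns -/

section Cross

variable (G : Subgroup 𝔸ˣ) (x : MemberY d ℓ hd hL b₀ b₁ Mstar) (par : SiteParY 𝔸 x.toKIdx) {ι : Type} [Fintype ι] [DecidableEq ι]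
  (b : Module.Basis ι ℝ 𝔸) (ιB : BlkY x.toKIdx → IBondY x.toKIdx) [Fintype (geo9Y x).Site] [DecidableEq (geo9Y x).Site]

/-- ★ **THE EXPLICIT CONSTANT OF THE INPUT-SIDE CROSS CONVERSIONS** (member-independent): `(1 + c_S·Λ·c₁(dL, δ₀, 1/12))²·(c_L·B₀)` with
`c_S = M₂(Σ‖b_i‖)√|ι|e^{δ₀·2(d+1)}`, `c_L = √|ι|·M₂·Σ‖b_i‖` (two cross steps at most). [cite: Balaban1985BackgroundPropagators, p.403 l.1–9 («of course with different constants»), bookkeeping] -/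
def crossConstL2 (M₂ Sb sι : ℝ) (d dL : ℕ) (δ₀ Λ B₀ : ℝ) : ℝ :=
  (1 + ((1 : ℝ) ^ 2 * M₂ * Sb * sι * Real.exp (δ₀ * (2 * ((d : ℝ) + 1)))) * Λ * B6.c1 dL δ₀ (1 / 12)) ^ 2 * ((sι * M₂ * Sb) * B₀)

/-- ★★ **ALL ORIENTATION PATTERNS OF THE WORDS WITH AT MOST ONE DIFFERENCE ON EACH SIDE, FROM THE RECORD's (3.46) BLOCK AT A `G`-VALUED `U`**: with (2.61)
at `(δ₀, 1/12)` (exponent `dL`) and the transfers of `ℓ`, `ℓ²` at `(δ₀, 1/12)` (constant `Λ ≧ 1`) given, `L2Block (kernelFamilyS … id (GpY par) par) B₀ δ₀ U`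
(`B₀ ≧ 0`) gives at rate `δ₀/2`, constant `c_X·(c_L·B₀)` with `c_X = (1 + c_S·Λ·c₁)²`, `c_S = M₂(Σ‖b_i‖)√|ι|e^{δ₀·2(d+1)}`: `η²G′(U) ≺₂ …ℓ²`, every
`∇♯_k·η²G′(U)` and `η²G′(U)·∇♯_k` `≺₂ …ℓ`, every `∇♯_k·η²G′(U)·∇♯_l ≺₂ …1` — the words the augmented members 0, 1, 2, 4 of `KSC₃` read at `base U`.
[cite: Balaban1985BackgroundPropagators, Thm 3.1 (3.46) p.398, p.398 (first remark), p.403 l.1–9; Balaban1984PropagatorsII, Prop. 2.6 (2.140)–(2.141) p.247, Lemma 2.1 p.234] -/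
theorem hasL2Majorant_allPatterns_of_l2Block (hι : ∀ s : BlkY x.toKIdx, β x.toKIdx.hN x.toKIdx.D x.toKIdx.hk (ιB s) = s)
    (hG1 : ∀ u : 𝔸ˣ, u ∈ G → ‖(u : 𝔸)‖ ≤ 1) {M₂ : ℝ} (hM₂ : 0 ≤ M₂) (hrepr : ∀ (v : 𝔸) (j : ι), |b.repr v j| ≤ M₂ * ‖v‖)
    {δ₀ : ℝ} (hδ₀ : 0 < δ₀) {dL : ℕ} (h261 : Ineq261 dL (toB6 (geo9Y x) (0 : ℝ) True) δ₀ (1 / 12)) {Λ : ℝ} (hΛ : 1 ≤ Λ)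
    (hT1 : ScaleTransfer (geo9Y x) δ₀ (1 / 12) Λ (fun a => (geo9Y x).len a))
    {B₀ : ℝ} (hB₀ : 0 ≤ B₀) {U : CfgY 𝔸 x.toKIdx} (hU : GVal G x.toKIdx U)
    (hL2 : L2Block (kernelFamilyS x.toKIdx (bg9Y 𝔸 G x) (fun U => U) (GpY x.toKIdx par) par) B₀ δ₀ U) :
    (∀ k l : Fin (d + 1) ⊕ Fin (d + 1), HasL2Majorant (g := toB6 (geo9Y x) (0 : ℝ) True) (fun p : SiteY x.toKIdx × ι => blkC x.toKIdx ιB p.1)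
        (conj b (wordL x.toKIdx (GpY x.toKIdx par) U U (kGeo x.toKIdx).eta 0 k l))
        (fun a a' => crossConstL2 M₂ (∑ j, ‖b j‖) (Real.sqrt (Fintype.card ι)) d dL δ₀ Λ B₀ * B9.pref6 ((geo9Y x).len a) 0 * Real.exp (-(δ₀ / 2 * (geo9Y x).dist a a')))) ∧
      (∀ k l : Fin (d + 1) ⊕ Fin (d + 1), HasL2Majorant (g := toB6 (geo9Y x) (0 : ℝ) True) (fun p : SiteY x.toKIdx × ι => blkC x.toKIdx ιB p.1)
        (conj b (wordL x.toKIdx (GpY x.toKIdx par) U U (kGeo x.toKIdx).eta 1 k l))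
        (fun a a' => crossConstL2 M₂ (∑ j, ‖b j‖) (Real.sqrt (Fintype.card ι)) d dL δ₀ Λ B₀ * B9.pref6 ((geo9Y x).len a) 1 * Real.exp (-(δ₀ / 2 * (geo9Y x).dist a a')))) ∧
      (∀ k l : Fin (d + 1) ⊕ Fin (d + 1), HasL2Majorant (g := toB6 (geo9Y x) (0 : ℝ) True) (fun p : SiteY x.toKIdx × ι => blkC x.toKIdx ιB p.1)
        (conj b (wordL x.toKIdx (GpY x.toKIdx par) U U (kGeo x.toKIdx).eta 2 k l))
        (fun a a' => crossConstL2 M₂ (∑ j, ‖b j‖) (Real.sqrt (Fintype.card ι)) d dL δ₀ Λ B₀ * B9.pref6 ((geo9Y x).len a) 2 * Real.exp (-(δ₀ / 2 * (geo9Y x).dist a a')))) ∧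
      (∀ k l : Fin (d + 1) ⊕ Fin (d + 1), HasL2Majorant (g := toB6 (geo9Y x) (0 : ℝ) True) (fun p : SiteY x.toKIdx × ι => blkC x.toKIdx ιB p.1)
        (conj b (wordL x.toKIdx (GpY x.toKIdx par) U U (kGeo x.toKIdx).eta 4 k l))
        (fun a a' => crossConstL2 M₂ (∑ j, ‖b j‖) (Real.sqrt (Fintype.card ι)) d dL δ₀ Λ B₀ * B9.pref6 ((geo9Y x).len a) 4 * Real.exp (-(δ₀ / 2 * (geo9Y x).dist a a')))) := by
  set cS : ℝ := (1 : ℝ) ^ 2 * M₂ * (∑ i, ‖b i‖) * Real.sqrt (Fintype.card ι) * Real.exp (δ₀ * (2 * ((d : ℝ) + 1))) with hcS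
  set Bx : ℝ := crossConstL2 M₂ (∑ j, ‖b j‖) (Real.sqrt (Fintype.card ι)) d dL δ₀ Λ B₀ with hBxdef
  -- constants and geometry
  set η : ℝ := (kGeo x.toKIdx).eta with hηdef
  have hη0 : 0 < η := geo9K_eta_pos x.toKIdx
  set cL : ℝ := Real.sqrt (Fintype.card ι) * M₂ * ∑ j, ‖b j‖ with hcL
  set Bin : ℝ := cL * B₀ with hBin
  set c₁ : ℝ := B6.c1 dL δ₀ (1 / 12) with hc₁
  set gX : ℝ := 1 + cS * Λ * c₁ with hgX
  set d₀ : ℝ := 2 * ((d : ℝ) + 1) with hd₀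
  have hSb : 0 ≤ ∑ i, ‖b i‖ := Finset.sum_nonneg fun i _ => norm_nonneg _
  have hcL0 : 0 ≤ cL := by positivity
  have hBin0 : 0 ≤ Bin := mul_nonneg hcL0 hB₀
  have hΛ0 : 0 ≤ Λ := le_trans zero_le_one hΛ
  have hc₁0 : 0 ≤ c₁ := B6RandomWalk.c1_nonneg dL δ₀ (1 / 12)
  have hcS0 : 0 ≤ cS := by positivity
  have hgX1 : 1 ≤ gX := by rw [hgX]; exact le_add_of_nonneg_right (by positivity)
  have hgX0 : 0 ≤ gX := le_trans zero_le_one hgX1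
  have hBx : Bx = gX ^ 2 * Bin := by rw [hBxdef, hgX, hcS, hc₁, hBin, hcL]; rfl
  have hdnn : ∀ y y' : (geo9Y x).Site, 0 ≤ (geo9Y x).dist y y' := geo9Y_dist_nonneg x
  have htri : Triangle254 (toB6 (geo9Y x) (0 : ℝ) True) := fun p q r => geo9Y_dist_triangle x p q r
  have hlen : ∀ y : (geo9Y x).Site, 0 < (geo9Y x).len y := geo9Y_len_pos x
  have hwℓ : ∀ p : (geo9Y x).Site, 0 ≤ (geo9Y x).len p := fun p => (hlen p).le
  have hd₀F : ∀ (μ : Fin (d + 1)) (z : SiteY x.toKIdx), (geo9Y x).dist (blkC x.toKIdx ιB z) (blkC x.toKIdx ιB (shiftY x.toKIdx μ z)) ≤ d₀ :=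
    fun μ z => stencilF_blkC x.toKIdx ιB hι μ z
  have hd₀B : ∀ (μ : Fin (d + 1)) (z : SiteY x.toKIdx), (geo9Y x).dist (blkC x.toKIdx ιB z) (blkC x.toKIdx ιB ((shiftY x.toKIdx μ).symm z)) ≤ d₀ :=
    fun μ z => stencilB_blkC x.toKIdx ιB hι μ z
  have hρu : ∀ (μ : Fin (d + 1)) (z : SiteY x.toKIdx), ‖((UboxY x.toKIdx U μ z : 𝔸ˣ) : 𝔸)‖ ≤ 1 ∧ ‖(((UboxY x.toKIdx U μ z)⁻¹ : 𝔸ˣ) : 𝔸)‖ ≤ 1 :=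
    fun μ z => norm_le_one_and_inv_of_mem G hG1 (hU μ _ : UboxY x.toKIdx U μ z ∈ G)
  -- the transfer of the constant weight holds with any `Λ ≧ 1`
  have hT0 : ScaleTransfer (geo9Y x) δ₀ (1 / 12) Λ (fun _ => (1 : ℝ)) := fun y y' => by
    rw [mul_one, mul_one]
    have : Real.exp (-(1 / 12 * δ₀ * (geo9Y x).dist y y')) ≤ 1 := Real.exp_le_one_iff.2 (by nlinarith [hdnn y y', hδ₀.le])
    exact this.trans hΛ
  -- the letters
  set Gu : Module.End ℝ (SiteY x.toKIdx → 𝔸) := (η ^ 2) • (GpY x.toKIdx par U).restrictScalars ℝ with hGu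
  set D : Fin (d + 1) ⊕ Fin (d + 1) → Module.End ℝ (SiteY x.toKIdx → 𝔸) := fun k => diffLetter (shiftY x.toKIdx) (UboxY x.toKIdx U) (((η : ℂ))⁻¹) k
    with hD
  -- READ the record (print's patterns), rate δ₀, constant Bin
  have hK : ∀ (n : Fin 6) (p q : (geo9Y x).Site), (Real.sqrt (Fintype.card ι) * M₂ * ∑ j, ‖b j‖) * B₀ * B9.pref6 ((geo9Y x).len p) n *
      Real.exp (-(δ₀ * (geo9Y x).dist p q)) = Bin * B9.pref6 ((geo9Y x).len p) n * Real.exp (-(δ₀ * (geo9Y x).dist p q)) := fun n p q => by rw [hBin, hcL]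
  have r0 : HasL2Majorant (g := toB6 (geo9Y x) (0 : ℝ) True) (fun p : SiteY x.toKIdx × ι => blkC x.toKIdx ιB p.1) (conj b Gu)
      (fun p q => Bin * (geo9Y x).len p ^ 2 * Real.exp (-(δ₀ * (geo9Y x).dist p q))) := by
    have h := B9SectBL2ReadingsY.hasL2Majorant_conj_of_l2Block x ιB b hι hM₂ hrepr (0 : ℝ) True (bg9Y 𝔸 G x) (fun U => U) (GpY x.toKIdx par) par hB₀ hL2
    exact hasL2Majorant_mono (g := toB6 (geo9Y x) (0 : ℝ) True) _ h fun p q => le_of_eq (by rw [hBin, hcL])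
  have rr := fun μ ν => hasL2Majorant_recordWords_of_l2Block x ιB b hι hM₂ hrepr (0 : ℝ) True (B := bg9Y 𝔸 G x) (fun U => U) (GpY x.toKIdx par) par hB₀
    hL2 μ ν
  have r1 : ∀ μ, HasL2Majorant (g := toB6 (geo9Y x) (0 : ℝ) True) (fun p : SiteY x.toKIdx × ι => blkC x.toKIdx ιB p.1) (conj b (D (Sum.inl μ)) * conj b Gu)
      (fun p q => Bin * (geo9Y x).len p * Real.exp (-(δ₀ * (geo9Y x).dist p q))) := fun μ => by
    have h : HasL2Majorant (g := toB6 (geo9Y x) (0 : ℝ) True) (fun p : SiteY x.toKIdx × ι => blkC x.toKIdx ιB p.1) (conj b (D (Sum.inl μ) * Gu))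
        (fun a a' => (Real.sqrt (Fintype.card ι) * M₂ * ∑ j, ‖b j‖) * B₀ * B9.pref6 ((geo9Y x).len a) 1 * Real.exp (-(δ₀ * (geo9Y x).dist a a'))) :=
      (rr μ μ).1
    rw [B9Eq352DivFormLetters.conj_mul] at h
    exact hasL2Majorant_mono (g := toB6 (geo9Y x) (0 : ℝ) True) _ h fun p q => le_of_eq (by rw [hK]; rfl)
  have r2 : ∀ μ, HasL2Majorant (g := toB6 (geo9Y x) (0 : ℝ) True) (fun p : SiteY x.toKIdx × ι => blkC x.toKIdx ιB p.1) (conj b Gu * conj b (D (Sum.inr μ)))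
      (fun p q => Bin * (geo9Y x).len p * Real.exp (-(δ₀ * (geo9Y x).dist p q))) := fun μ => by
    have h : HasL2Majorant (g := toB6 (geo9Y x) (0 : ℝ) True) (fun p : SiteY x.toKIdx × ι => blkC x.toKIdx ιB p.1) (conj b (Gu * D (Sum.inr μ)))
        (fun a a' => (Real.sqrt (Fintype.card ι) * M₂ * ∑ j, ‖b j‖) * B₀ * B9.pref6 ((geo9Y x).len a) 2 * Real.exp (-(δ₀ * (geo9Y x).dist a a'))) :=
      (rr μ μ).2.1
    rw [B9Eq352DivFormLetters.conj_mul] at h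
    exact hasL2Majorant_mono (g := toB6 (geo9Y x) (0 : ℝ) True) _ h fun p q => le_of_eq (by rw [hK]; rfl)
  have r4 : ∀ μ ν, HasL2Majorant (g := toB6 (geo9Y x) (0 : ℝ) True) (fun p : SiteY x.toKIdx × ι => blkC x.toKIdx ιB p.1)
      (conj b (D (Sum.inl μ)) * conj b Gu * conj b (D (Sum.inr ν))) (fun p q => Bin * 1 * Real.exp (-(δ₀ * (geo9Y x).dist p q))) := fun μ ν => by
    have h : HasL2Majorant (g := toB6 (geo9Y x) (0 : ℝ) True) (fun p : SiteY x.toKIdx × ι => blkC x.toKIdx ιB p.1) (conj b (D (Sum.inl μ) * Gu * D (Sum.inr ν)))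
        (fun a a' => (Real.sqrt (Fintype.card ι) * M₂ * ∑ j, ‖b j‖) * B₀ * B9.pref6 ((geo9Y x).len a) 4 * Real.exp (-(δ₀ * (geo9Y x).dist a a'))) :=
      (rr μ ν).2.2.2.1
    rw [B9Eq352DivFormLetters.conj_mul, B9Eq352DivFormLetters.conj_mul] at h
    exact hasL2Majorant_mono (g := toB6 (geo9Y x) (0 : ℝ) True) _ h fun p q => le_of_eq (by rw [hK]; rfl)
  -- rates
  set ρ₁ : ℝ := 5 * δ₀ / 6 with hρ₁
  set ρ₂ : ℝ := 2 * δ₀ / 3 with hρ₂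
  have hρ₁0 : 0 ≤ ρ₁ := by rw [hρ₁]; positivity
  have hρ₂0 : 0 ≤ ρ₂ := by rw [hρ₂]; positivity
  have hr₁ : ρ₁ + (1 / 12 + 1 / 12) * δ₀ ≤ δ₀ := by rw [hρ₁]; linarith
  have hρ₁δ : ρ₁ ≤ δ₀ := by rw [hρ₁]; linarith
  have hr₂ : ρ₂ + (1 / 12 + 1 / 12) * δ₀ ≤ ρ₁ := by rw [hρ₁, hρ₂]; linarith
  have hρ₂₁ : ρ₂ ≤ ρ₁ := by rw [hρ₁, hρ₂]; linarith
  have hαδ : 0 ≤ 1 / 12 * δ₀ := by positivity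
  have hcS_eq : ∀ r : ℝ, (1 : ℝ) ^ 2 * M₂ * (∑ i, ‖b i‖) * Real.sqrt (Fintype.card ι) * Real.exp (r * d₀) ≤ cS ↔ Real.exp (r * d₀) ≤ Real.exp (δ₀ * d₀) ∨
      (1 : ℝ) ^ 2 * M₂ * (∑ i, ‖b i‖) * Real.sqrt (Fintype.card ι) * Real.exp (r * d₀) ≤ cS := fun r => by
    constructor
    · exact fun h => Or.inr h
    · rintro (h | h)
      · exact mul_le_mul_of_nonneg_left h (by positivity)
      · exact h
  have hcS_le : ∀ r : ℝ, r ≤ δ₀ → (1 : ℝ) ^ 2 * M₂ * (∑ i, ‖b i‖) * Real.sqrt (Fintype.card ι) * Real.exp (r * d₀) ≤ cS := fun r hr =>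
    (hcS_eq r).2 (Or.inl (Real.exp_le_exp.2 (mul_le_mul_of_nonneg_right hr (by rw [hd₀]; positivity))))
  -- the generic step constants are bounded by gX·(input constant)
  have hstep : ∀ (r Bc : ℝ), r ≤ δ₀ → 0 ≤ Bc →
      (1 : ℝ) ^ 2 * M₂ * (∑ i, ‖b i‖) * Real.sqrt (Fintype.card ι) * Real.exp (r * d₀) * Λ * B6.c1 dL δ₀ (1 / 12) * Bc ≤ gX * Bc := by
    intro r Bc hr hBc
    have h1 : (1 : ℝ) ^ 2 * M₂ * (∑ i, ‖b i‖) * Real.sqrt (Fintype.card ι) * Real.exp (r * d₀) * Λ * B6.c1 dL δ₀ (1 / 12) ≤ cS * Λ * c₁ :=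
      mul_le_mul_of_nonneg_right (mul_le_mul_of_nonneg_right (hcS_le r hr) hΛ0) hc₁0
    have h2 : cS * Λ * c₁ ≤ gX := by rw [hgX]; linarith
    exact mul_le_mul_of_nonneg_right (h1.trans h2) hBc
  -- the first-order cross conversions (one step, rate ρ₁)
  have x1 : ∀ μ, HasL2Majorant (g := toB6 (geo9Y x) (0 : ℝ) True) (fun p : SiteY x.toKIdx × ι => blkC x.toKIdx ιB p.1) (conj b (D (Sum.inr μ)) * conj b Gu)
      (fun p q => (gX * Bin) * (geo9Y x).len p * Real.exp (-(ρ₁ * (geo9Y x).dist p q))) := fun μ => by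
    have h := hasL2Majorant_cross_left b (shiftY x.toKIdx) (UboxY x.toKIdx U) (Rr := (0 : ℝ)) (H := True) (g := geo9Y x) (fun z => blkC x.toKIdx ιB z) dL
      (((η : ℂ))⁻¹) 1 d₀ M₂ δ₀ δ₀ (1 / 12) (1 / 12) ρ₁ Λ Bin (fun p => (geo9Y x).len p) hwℓ hδ₀.le hM₂ hBin0 hΛ0 hρ₁0 hr₁ hρ₁δ hrepr hdnn htri h261 hT1
      hρu hd₀B μ (Gp := conj b Gu) (r1 μ)
    exact hasL2Majorant_mono (g := toB6 (geo9Y x) (0 : ℝ) True) _ h fun p q =>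
      mul_le_mul_of_nonneg_right (mul_le_mul_of_nonneg_right (hstep δ₀ Bin le_rfl hBin0) (hwℓ p)) (Real.exp_nonneg _)
  have x2 : ∀ μ, HasL2Majorant (g := toB6 (geo9Y x) (0 : ℝ) True) (fun p : SiteY x.toKIdx × ι => blkC x.toKIdx ιB p.1) (conj b Gu * conj b (D (Sum.inl μ)))
      (fun p q => (gX * Bin) * (geo9Y x).len p * Real.exp (-(ρ₁ * (geo9Y x).dist p q))) := fun μ => by
    have h := hasL2Majorant_cross_right b (shiftY x.toKIdx) (UboxY x.toKIdx U) (Rr := (0 : ℝ)) (H := True) (g := geo9Y x) (fun z => blkC x.toKIdx ιB z) dL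
      (((η : ℂ))⁻¹) 1 d₀ M₂ δ₀ δ₀ (1 / 12) (1 / 12) ρ₁ Λ Bin (fun p => (geo9Y x).len p) hwℓ hM₂ hBin0 hΛ hρ₁0 hr₁ hαδ hrepr hdnn htri h261
      hρu hd₀F μ (Gp := conj b Gu) (r2 μ)
    exact hasL2Majorant_mono (g := toB6 (geo9Y x) (0 : ℝ) True) _ h fun p q =>
      mul_le_mul_of_nonneg_right (mul_le_mul_of_nonneg_right (hstep ρ₁ Bin hρ₁δ hBin0) (hwℓ p)) (Real.exp_nonneg _)
  -- the mixed words: (inl, inr) read; (inr, inr) by a left cross; (inl, inl) by a right cross; (inr, inl) by both (rate ρ₂)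
  have m_rr : ∀ μ ν, HasL2Majorant (g := toB6 (geo9Y x) (0 : ℝ) True) (fun p : SiteY x.toKIdx × ι => blkC x.toKIdx ιB p.1)
      (conj b (D (Sum.inr μ)) * (conj b Gu * conj b (D (Sum.inr ν)))) (fun p q => (gX * Bin) * 1 * Real.exp (-(ρ₁ * (geo9Y x).dist p q))) := fun μ ν => by
    have hin : HasL2Majorant (g := toB6 (geo9Y x) (0 : ℝ) True) (fun p : SiteY x.toKIdx × ι => blkC x.toKIdx ιB p.1)
        (conj b (D (Sum.inl μ)) * (conj b Gu * conj b (D (Sum.inr ν)))) (fun p q => Bin * 1 * Real.exp (-(δ₀ * (geo9Y x).dist p q))) := by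
      rw [← mul_assoc]; exact r4 μ ν
    have h := hasL2Majorant_cross_left b (shiftY x.toKIdx) (UboxY x.toKIdx U) (Rr := (0 : ℝ)) (H := True) (g := geo9Y x) (fun z => blkC x.toKIdx ιB z) dL
      (((η : ℂ))⁻¹) 1 d₀ M₂ δ₀ δ₀ (1 / 12) (1 / 12) ρ₁ Λ Bin (fun _ => (1 : ℝ)) (fun _ => zero_le_one) hδ₀.le hM₂ hBin0 hΛ0 hρ₁0 hr₁ hρ₁δ hrepr hdnn htri
      h261 hT0 hρu hd₀B μ (Gp := conj b Gu * conj b (D (Sum.inr ν))) hin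
    exact hasL2Majorant_mono (g := toB6 (geo9Y x) (0 : ℝ) True) _ h fun p q =>
      mul_le_mul_of_nonneg_right (mul_le_mul_of_nonneg_right (hstep δ₀ Bin le_rfl hBin0) zero_le_one) (Real.exp_nonneg _)
  have m_ll : ∀ μ ν, HasL2Majorant (g := toB6 (geo9Y x) (0 : ℝ) True) (fun p : SiteY x.toKIdx × ι => blkC x.toKIdx ιB p.1)
      (conj b (D (Sum.inl μ)) * conj b Gu * conj b (D (Sum.inl ν))) (fun p q => (gX * Bin) * 1 * Real.exp (-(ρ₁ * (geo9Y x).dist p q))) := fun μ ν => by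
    have h := hasL2Majorant_cross_right b (shiftY x.toKIdx) (UboxY x.toKIdx U) (Rr := (0 : ℝ)) (H := True) (g := geo9Y x) (fun z => blkC x.toKIdx ιB z) dL
      (((η : ℂ))⁻¹) 1 d₀ M₂ δ₀ δ₀ (1 / 12) (1 / 12) ρ₁ Λ Bin (fun _ => (1 : ℝ)) (fun _ => zero_le_one) hM₂ hBin0 hΛ hρ₁0 hr₁ hαδ hrepr hdnn htri h261
      hρu hd₀F ν (Gp := conj b (D (Sum.inl μ)) * conj b Gu) (r4 μ ν)
    exact hasL2Majorant_mono (g := toB6 (geo9Y x) (0 : ℝ) True) _ h fun p q =>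
      mul_le_mul_of_nonneg_right (mul_le_mul_of_nonneg_right (hstep ρ₁ Bin hρ₁δ hBin0) zero_le_one) (Real.exp_nonneg _)
  have m_rl : ∀ μ ν, HasL2Majorant (g := toB6 (geo9Y x) (0 : ℝ) True) (fun p : SiteY x.toKIdx × ι => blkC x.toKIdx ιB p.1)
      (conj b (D (Sum.inr μ)) * (conj b Gu * conj b (D (Sum.inl ν)))) (fun p q => (gX * (gX * Bin)) * 1 * Real.exp (-(ρ₂ * (geo9Y x).dist p q))) :=
    fun μ ν => by
    have hin : HasL2Majorant (g := toB6 (geo9Y x) (0 : ℝ) True) (fun p : SiteY x.toKIdx × ι => blkC x.toKIdx ιB p.1)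
        (conj b (D (Sum.inl μ)) * (conj b Gu * conj b (D (Sum.inl ν)))) (fun p q => (gX * Bin) * 1 * Real.exp (-(ρ₁ * (geo9Y x).dist p q))) := by
      rw [← mul_assoc]; exact m_ll μ ν
    have h := hasL2Majorant_cross_left b (shiftY x.toKIdx) (UboxY x.toKIdx U) (Rr := (0 : ℝ)) (H := True) (g := geo9Y x) (fun z => blkC x.toKIdx ιB z) dL
      (((η : ℂ))⁻¹) 1 d₀ M₂ δ₀ ρ₁ (1 / 12) (1 / 12) ρ₂ Λ (gX * Bin) (fun _ => (1 : ℝ)) (fun _ => zero_le_one) hρ₁0 hM₂ (mul_nonneg hgX0 hBin0) hΛ0 hρ₂0 hr₂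
      hρ₂₁ hrepr hdnn htri h261 hT0 hρu hd₀B μ (Gp := conj b Gu * conj b (D (Sum.inl ν))) hin
    exact hasL2Majorant_mono (g := toB6 (geo9Y x) (0 : ℝ) True) _ h fun p q =>
      mul_le_mul_of_nonneg_right (mul_le_mul_of_nonneg_right (hstep ρ₁ (gX * Bin) hρ₁δ (mul_nonneg hgX0 hBin0)) zero_le_one) (Real.exp_nonneg _)
  -- assemble: common constant `Bx = gX²·Bin`, common rate `δ₀/2`
  have hBx0 : 0 ≤ Bx := by rw [hBx]; positivity
  have hle1 : Bin ≤ Bx := by rw [hBx]; exact le_mul_of_one_le_left hBin0 (one_le_pow₀ hgX1)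
  have hle2 : gX * Bin ≤ Bx := by
    rw [hBx, pow_two, mul_assoc]; exact le_mul_of_one_le_left (mul_nonneg hgX0 hBin0) hgX1
  have hle3 : gX * (gX * Bin) ≤ Bx := by rw [hBx, pow_two, mul_assoc]
  have mono : ∀ {Tm : Module.End ℝ (SiteY x.toKIdx × ι → ℝ)} {Bc r : ℝ} (n : Fin 6) (w : (geo9Y x).Site → ℝ), (∀ p, 0 ≤ w p) → 0 ≤ Bc → Bc ≤ Bx →
      δ₀ / 2 ≤ r → (∀ p, w p = B9.pref6 ((geo9Y x).len p) n) →
      HasL2Majorant (g := toB6 (geo9Y x) (0 : ℝ) True) (fun p : SiteY x.toKIdx × ι => blkC x.toKIdx ιB p.1) Tm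
        (fun p q => Bc * w p * Real.exp (-(r * (geo9Y x).dist p q))) →
      HasL2Majorant (g := toB6 (geo9Y x) (0 : ℝ) True) (fun p : SiteY x.toKIdx × ι => blkC x.toKIdx ιB p.1) Tm
        (fun p q => Bx * B9.pref6 ((geo9Y x).len p) n * Real.exp (-(δ₀ / 2 * (geo9Y x).dist p q))) := by
    intro Tm Bc r n w hw hBc hBcx hr hwn h
    have h' := hasL2Majorant_rate_mono (R := (0 : ℝ)) (H := True) (g := geo9Y x) _ Bc w hBc hw hr hdnn h
    exact hasL2Majorant_mono (g := toB6 (geo9Y x) (0 : ℝ) True) _ h' fun p q => by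
      rw [← hwn p]; exact mul_le_mul_of_nonneg_right (mul_le_mul_of_nonneg_right hBcx (hw p)) (Real.exp_nonneg _)
  have h01 : δ₀ / 2 ≤ ρ₁ := by rw [hρ₁]; linarith
  have h02 : δ₀ / 2 ≤ ρ₂ := by rw [hρ₂]; linarith
  have h00 : δ₀ / 2 ≤ δ₀ := by linarith
  refine ⟨fun k l => ?_, fun k l => ?_, fun k l => ?_, fun k l => ?_⟩
  · -- word 0: the record's own entry
    exact mono 0 (fun p => (geo9Y x).len p ^ 2) (fun p => sq_nonneg _) hBin0 hle1 h00 (fun p => rfl) r0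
  · -- word 1: `D k * Gu`
    show HasL2Majorant (g := toB6 (geo9Y x) (0 : ℝ) True) (fun p : SiteY x.toKIdx × ι => blkC x.toKIdx ιB p.1) (conj b (D k * Gu)) _
    rw [B9Eq352DivFormLetters.conj_mul]
    cases k with
    | inl μ => exact mono 1 (fun p => (geo9Y x).len p) hwℓ hBin0 hle1 h00 (fun p => rfl) (r1 μ)
    | inr μ => exact mono 1 (fun p => (geo9Y x).len p) hwℓ (mul_nonneg hgX0 hBin0) hle2 h01 (fun p => rfl) (x1 μ)
  · -- word 2: `Gu * D k`
    show HasL2Majorant (g := toB6 (geo9Y x) (0 : ℝ) True) (fun p : SiteY x.toKIdx × ι => blkC x.toKIdx ιB p.1) (conj b (Gu * D k)) _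
    rw [B9Eq352DivFormLetters.conj_mul]
    cases k with
    | inl μ => exact mono 2 (fun p => (geo9Y x).len p) hwℓ (mul_nonneg hgX0 hBin0) hle2 h01 (fun p => rfl) (x2 μ)
    | inr μ => exact mono 2 (fun p => (geo9Y x).len p) hwℓ hBin0 hle1 h00 (fun p => rfl) (r2 μ)
  · -- word 4: `D k * Gu * D l`
    show HasL2Majorant (g := toB6 (geo9Y x) (0 : ℝ) True) (fun p : SiteY x.toKIdx × ι => blkC x.toKIdx ιB p.1) (conj b (D k * Gu * D l)) _
    rw [B9Eq352DivFormLetters.conj_mul, B9Eq352DivFormLetters.conj_mul]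
    cases k with
    | inl μ =>
      cases l with
      | inl ν => exact mono 4 (fun _ => (1 : ℝ)) (fun _ => zero_le_one) (mul_nonneg hgX0 hBin0) hle2 h01 (fun p => rfl) (m_ll μ ν)
      | inr ν => exact mono 4 (fun _ => (1 : ℝ)) (fun _ => zero_le_one) hBin0 hle1 h00 (fun p => rfl) (r4 μ ν)
    | inr μ =>
      cases l with
      | inl ν =>
        rw [mul_assoc]
        exact mono 4 (fun _ => (1 : ℝ)) (fun _ => zero_le_one) (mul_nonneg hgX0 (mul_nonneg hgX0 hBin0)) hle3 h02 (fun p => rfl) (m_rl μ ν)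
      | inr ν =>
        rw [mul_assoc]
        exact mono 4 (fun _ => (1 : ℝ)) (fun _ => zero_le_one) (mul_nonneg hgX0 hBin0) hle2 h01 (fun p => rfl) (m_rr μ ν)

end Cross

/-! ## §3 ★★ The augmented members 0, 1, 2, 4 of `KSC₃` at a base from the record's (3.46) block -/

section Members

variable (G : Subgroup 𝔸ˣ) (x : MemberY d ℓ hd hL b₀ b₁ Mstar) (par : SiteParY 𝔸 x.toKIdx) {ι : Type} [Fintype ι] [DecidableEq ι]
  (b : Module.Basis ι ℝ 𝔸) (ιB : BlkY x.toKIdx → IBondY x.toKIdx) [Fintype (geo9Y x).Site] [DecidableEq (geo9Y x).Site]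
  (C37 C38 : ℝ → CfgY 𝔸 x.toKIdx → AfldY 𝔸 x.toKIdx → Prop)

omit [NormedRing 𝔸] [NormedAlgebra ℂ 𝔸] [CompleteSpace 𝔸] [FiniteDimensional ℝ 𝔸] in
/-- the constant of §2 is nonnegative. [cite: Balaban1985BackgroundPropagators, p.403 l.1–9, bookkeeping] -/
theorem crossConstL2_nonneg {M₂ Sb sι : ℝ} (hM₂ : 0 ≤ M₂) (hSb : 0 ≤ Sb) (hsι : 0 ≤ sι) (d dL : ℕ) (δ₀ Λ : ℝ) {B₀ : ℝ} (hB₀ : 0 ≤ B₀) :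
    0 ≤ crossConstL2 M₂ Sb sι d dL δ₀ Λ B₀ := by
  unfold crossConstL2; positivity

/-- ★★ **THE AUGMENTED (3.46) MEMBERS 0, 1, 2, 4 OF `KSC₃` AT A BASE FROM THE RECORD's BLOCK** — the plaquette-free part of `hin` for the `L²` member: at a
member with a section `ιB` of `β`, unit-norm structure group, (2.61) and the transfer of `ℓ` at `(δ₀, 1/12)` (constant `Λ ≧ 1`) given, a `G`-valued `U` with
the record's `L2Block … B₀ δ₀ U` (`B₀ ≧ 0`): members `n ∈ {0, 1, 2, 4}` of `KSC₃` at `base U` satisfy their (3.46) block with constant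
`c_L·crossConstL2 …` and rate `δ₀/2`.  (Members 3, 5 are NOT produced here — LOCATED, module header.)
[cite: Balaban1985BackgroundPropagators, Thm 3.1 (3.46) p.398, p.398 (first remark), Thm 3.4 p.400, p.403 l.1–9; Balaban1984PropagatorsII, Prop. 2.6 (2.140)–(2.141) p.247, Lemma 2.1 p.234] -/
theorem l2_KSC₃_base_of_record (hι : ∀ s : BlkY x.toKIdx, β x.toKIdx.hN x.toKIdx.D x.toKIdx.hk (ιB s) = s)
    (hG1 : ∀ u : 𝔸ˣ, u ∈ G → ‖(u : 𝔸)‖ ≤ 1) {M₂ : ℝ} (hM₂ : 0 ≤ M₂) (hrepr : ∀ (v : 𝔸) (j : ι), |b.repr v j| ≤ M₂ * ‖v‖)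
    {δ₀ : ℝ} (hδ₀ : 0 < δ₀) {dL : ℕ} (h261 : Ineq261 dL (toB6 (geo9Y x) (0 : ℝ) True) δ₀ (1 / 12)) {Λ : ℝ} (hΛ : 1 ≤ Λ)
    (hT1 : ScaleTransfer (geo9Y x) δ₀ (1 / 12) Λ (fun a => (geo9Y x).len a))
    {B₀ : ℝ} (hB₀ : 0 ≤ B₀) {U : CfgY 𝔸 x.toKIdx} (hU : GVal G x.toKIdx U)
    (hL2 : L2Block (kernelFamilyS x.toKIdx (bg9Y 𝔸 G x) (fun U => U) (GpY x.toKIdx par) par) B₀ δ₀ U)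
    (n : Fin 6) (hn : n = 0 ∨ n = 1 ∨ n = 2 ∨ n = 4)
    (lam : (geo9Y x).Loc) (h : (geo9Y x).Cut) (y y' : IBondY x.toKIdx) (hcut : (geo9Y x).cutIn h y) (hsupp : (geo9Y x).suppIn lam y') :
    (KSC₃ G x par C37 C38).l2 n (.base U) lam h ≤
      ((Real.sqrt (Fintype.card ι) * M₂ * ∑ j, ‖b j‖) * crossConstL2 M₂ (∑ j, ‖b j‖) (Real.sqrt (Fintype.card ι)) d dL δ₀ Λ B₀) *
        B9.pref6 ((geo9Y x).len y) n * (geo9Y x).cutSup h * Real.exp (-(δ₀ / 2 * (geo9Y x).dist y y')) * (geo9Y x).l2Norm lam := by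
  obtain ⟨h0, h1, h2, h4⟩ := hasL2Majorant_allPatterns_of_l2Block G x par b ιB hι hG1 hM₂ hrepr hδ₀ h261 hΛ hT1 hB₀ hU hL2
  have hSb : 0 ≤ ∑ j, ‖b j‖ := Finset.sum_nonneg fun j _ => norm_nonneg _
  have hBx0 : 0 ≤ crossConstL2 M₂ (∑ j, ‖b j‖) (Real.sqrt (Fintype.card ι)) d dL δ₀ Λ B₀ :=
    crossConstL2_nonneg hM₂ hSb (Real.sqrt_nonneg _) d dL δ₀ Λ hB₀
  rw [KSC₃_l2]
  refine l2AugS_le_of_hasL2Majorant_wordL x ιB b hι hM₂ hrepr (0 : ℝ) True (B := (codingYx G x C37 C38).bg) (fun c => c) (GpY x.toKIdx par) hBx0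
    (c := .base U) n (fun k l => ?_) lam h y y' hcut hsupp
  rcases hn with rfl | rfl | rfl | rfl
  · exact h0 k l
  · exact h1 k l
  · exact h2 k l
  · exact h4 k l

end Members

end Literature.MathematicalPhysics.QuantumFieldTheory.Balaban1983to89.B9SectBL2TransferInY

end
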